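import Literature.MathematicalPhysics.QuantumFieldTheory.Balaban1983to89.B9Eq323KatoDomination

/-!
# `Balaban1983to89.B9Eq373KatoPairedRemainder` — T. Bałaban, *Propagators for lattice gauge theories in a background field*, Commun. Math. Phys. **99** (1985)
# 389–434 [Balaban1985BackgroundPropagators] (3.23) p. 394 (the covariant site Laplacian `Δ^η_U = D*_U D_U`), (3.70)–(3.73) pp. 404–405 (the expansion of the
# covariant Laplacian of a product background `U′U` around that of `U`, whose first-order remainder `V₁(A)` is bounded by COVARIANT DERIVATIVES —
# (3.73) *«|(V₁(A)A′)(b)| ≤ O(1)(|∇A||A′| + |A||∇A′| + |A|²|A′|) … The derivatives are, of course, the covariant derivatives defined by U»*):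
# **THE TWO-BACKGROUND REMAINDER OF THE KATO-FORM SITE OPERATOR IN PAIRED FORM — for two transporter data `(R, S)` and `(R′, S′)` on the same lattice,
# `(Δ_{R,S} − Δ_{R′,S′})v(x) = −η⁻²Σ_μ [B(x,μ)·η(D′v)(x,μ) − (S − S′)(x−e_μ,μ)·η(D′v)(x−e_μ,μ) + (∇_U B)(x,μ)·v(x) + S(x−e_μ,μ)B(x−e_μ,μ)²R′(x−e_μ,μ)·v(x)]`
# with the RELATIVE TRANSPORTER `B(b) = R(b)S′(b) − 1`, its `U`-covariant backward difference `(∇_U B)(x,μ) = B(x,μ) − S(x−e_μ,μ)B(x−e_μ,μ)R(x−e_μ,μ)` and the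
# `U′`-covariant derivative `D′`; hence `‖(Δ_{R,S} − Δ_{R′,S′})v(x)‖ ≤ |t|·b·Σ_μ(‖(D′v)(x,μ)‖ + ‖(D′v)(x−e_μ,μ)‖) + d·t²·(b′ + b²)·‖v(x)‖` when `‖B‖, ‖S − S′‖ ≤ b`
# and `‖∇_U B‖ ≤ b′` — FIRST ORDER in the `U′`-gradients, the zeroth order carrying the DIFFERENCED and the SQUARED relative transporter only: NO `η⁻¹·b·‖v‖`
# monomial (in the units `t = η⁻¹`, `b = ηa`, `b′ = η²a′`: `≤ a·Σ_μ(‖D′v‖ + ‖D′v‖) + d(a′ + a²)‖v(x)‖`, `η`-free)** — the (PV) letter of «storey J» of the NE9 chain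
# (one background against a pure gauge, or two backgrounds: route R2′'s background-Lipschitz modulus), the paired sup-currency companion of the crude
# `L²` remainder `B9Eq373DerivativeRemainderTwoBackgrounds.norm_covLaplaceSiteK_sub_le₂` (`4(1+ε_R)‖c‖²dδ_R`, which keeps `η⁻²δ_R`)

statement-level skeleton of published theorems with citation tags; proofs where landed; nothing here is a claim about the Yang–Mills mass gap

CITATION HEADER (lean-in-tree rule).  Audit cell `pub-balaban`, sub-cell `t4`, BINDER row NE9; filed by NE9 crux-team LEAF PROVER 05
(`b2b-balaban-t4-ne9-formalise-leaf-05`, gen 82).  MATHEMATICS: t4-ne9-idea-1 (NE9 crux ideation lens 1), gen 123 `t4/ideate/NE9/lens1-g123/PJ1B-PROOF-g123.md` §8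
(P-J-2, the (PV) pairing identity: `unitarity_word`, `pairing_identity`, certificate `PJ1B_skeleton_g123.NOT-TO-FILE.lean` a6db0a2a809d7ab8 §PJ2) and gen 131
`lens1-g131/PJ4-TWO-BACKGROUNDS-g131.md` §1 (PV₂) (certificate `PJ4_two_backgrounds_g131.NOT-TO-FILE.lean`: `pairing_identity`, `paired_letter_identity`,
`pairing_norm_le` in an abstract ring) — credit theirs; ported here to LINEAR MAPS ACTING ON VECTORS (the identity needs only `S(b)R(b) = 1` for the three bonds involved)
and INSTANTIATED on the chain's (3.23) `B11Eq103H1Complex.covLaplaceSiteK` through `B9Eq323KatoDomination.equiv_covLaplaceSiteK_eq_sum`, with the first-order terms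
named as the chain's `covDerivL2K` of the second background.  SOURCE READ first-hand in the held text layer [Balaban1985BackgroundPropagators]
(`paper:balaban1985-cmp99-background-propagators`, journal page = PDF page + 388): p. 394 (3.23); p. 404 *«Thus we have to investigate only an expansion of the
operator D*_{U′U}D_{U′U} … We do it in a way similar to (3.50)–(3.53)»*, (3.70)–(3.71) (`= (D*DA′)(x) − (V₁(A)A′)_μ(x)`); p. 405 (3.73) and *«The derivatives are, of
course, the covariant derivatives defined by U. The constant O(1) is an absolute constant depending on d only.»*  Print expands the BOND operator for `U′U`
against `U` with `U′ = exp(iηA)`; this file does the SITE operator (3.23) for two ARBITRARY transporter data, the relative transporter `B = RS′ − 1` playing `exp(iη ad A) − 1`.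
The algebra is [folklore]; nothing printed is a hypothesis.

WHY THIS FILE (cell context).  Storey J (t4-ne9-idea-1 gens 111–135; `lens1-g121/NABLA-ROW-STOREY-J-INTERFACE-g121.md` §2 (PV), gen 131 P-J-4) bounds the
covariant-gradient row of `G′(U)` by the fixed point `B9Eq342GradientRowBootstrap`; the background enters ONLY through the perturbation `V = (Δ_U − Δ_{U⁰})(χu)`
against a comparison (pure-gauge or second) background, which must be bounded WITHOUT the `η⁻¹·|A|·‖u‖` monomial of the unpaired bound (the lineage's recorded dead
end «bypass |∇A| ≤ 2η⁻¹|A|»; in the tree the unpaired bound is `B9Eq373DerivativeRemainderTwoBackgrounds.norm_covLaplaceSiteK_sub_le₂`).  Pairing the forward slot at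
`x` with the backward slot at `x − e_μ` and rewriting the two zeroth-order letters as a covariant DIFFERENCE of `B` plus `B²` is print's (3.73) mechanism; the letters
`b, b′` are then the sizes of `A` and `∇_U A` from the regularity condition (3.35) p. 396 (consumer's window), and the output feeds (PERT) of
`B9Eq342GradientRowBootstrap.norm_le_of_gradient_row_bootstrap` with `ε₁ ∝ a`, `ε₂ ∝ a′ + a²`.  For two backgrounds in the diagonal window it is the letter of P-J-4
(«the two-background VALUE row consumes the one-background GRADIENT row»).

WHAT IS PROVED (sorry-free; 0 `def`; [folklore]).
* §1 ONE DIRECTION, ABSTRACT (linear maps `Rp, Rp′, Sp′` on the forward bond, `Rm, Sm, Rm′, Sm′` on the backward bond, `Sp′Rp′ = 1`, `SmRm = 1`, `Sm′Rm′ = 1`;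
  vectors `v₊, v₀, v₋`): **`pairing_identity`** —
  `(Rp′v₊ − Rp v₊) + (Sm′v₋ − Sm v₋) = −Bx(Rp′v₊ − v₀) + (Sm − Sm′)(Rm′v₀ − v₋) − [(Bx v₀ − Sm Bm Rm v₀) + Sm Bm Bm Rm′ v₀]`, `Bx = RpSp′ − 1`, `Bm = RmSm′ − 1`, written
  out; **`norm_pairing_le`** — `≤ b‖Rp′v₊ − v₀‖ + b‖Rm′v₀ − v₋‖ + (b′ + b²)‖v₀‖` under `‖Bx‖, ‖Sm − Sm′‖, ‖Bm‖ ≤ b`, `‖Bx − Sm Bm Rm‖ ≤ b′`, `‖Sm‖, ‖Rm′‖ ≤ 1`.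
* §2 THE CHAIN's (3.23), two data `(R,S)`, `(R′,S′)` with `S b (R b w) = w`, `S′ b (R′ b w) = w`, real `t`: **`equiv_covLaplaceSiteK_sub_eq_sum`** (raw:
  `t²Σ_μ[(S′−S)(x−e_μ,μ)f(x−e_μ) + (R′−R)(x,μ)f(x+e_μ)]`); **`norm_equiv_covLaplaceSiteK_sub_le_paired`** —
  `‖(Δ_{R,S}f)(x) − (Δ_{R′,S′}f)(x)‖ ≤ |t|·b·Σ_μ(‖(D′f)(x,μ)‖ + ‖(D′f)(x−e_μ,μ)‖) + d·(t²(b′ + b²))·‖f(x)‖`, `D′f = WL2.equiv (covDerivL2K 𝕜 c₀ t R′ f)` BY NAME, under the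
  five letters at the `2d` bonds at `x` (binders; the consumer derives them from its window).
HONEST SCOPE.  Lattice algebra + triangle inequality at ONE site; the letters `b, b′` are hypotheses (print's `O(1)|A|`, `O(1)|∇_U A|` under (3.35) are the
consumer's to supply: `B9Eq384RemainderLetters` ∕ `B9Eq3101ConjugationLettersChain` hold the one-transporter letters); the averaging penalty `a′Q′*Q′` and the
bond operators of (3.70)–(3.75) are NOT treated; nothing of Bałaban's asserted.  ONE letter of ONE un-opened storey (J) of row L13 of `t4/ROUTES-NE9.md`.  NOT summit
progress (cell pub-balaban: NE9 NOT PRINTED ∕ NOT PROVED; «NE9 ⇐ the named binders»; row WALLED ON A MODEL (O-NE9-1; #5 UNRULED); spine PROVED 0∕9; rung (B)+1 finite T⁴ —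
NOT infinite volume, NOT mass gap, NOT BetaPertH, NOT Clay).  HONEST DEPENDENCY (cell line): continuum YM on T⁴ ⇐ BetaPertH ∧ nine spine estimates (0/9 proved); BetaPertH ⇐
(D1) ∧ (D4) ∧ CAP+tail; G-an2-4 gates asym, D1 and NE2/3/4.  NEW file importing `B9Eq323KatoDomination` only; nothing modified.  Net new unproved facts: 0.
-/

noncomputable section

open scoped BigOperators

namespace Literature.MathematicalPhysics.QuantumFieldTheory.Balaban1983to89.B9Eq373KatoPairedRemainder

open B4Sect5Torus (TSite)
open B9SectCLatticeCarrier (Bond shift unshift shift_unshift)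
open B9Eq33CovDerivVector (covDeriv covDeriv_apply_dir)
open B9Eq311L2Pairing (WL2)
open B11Eq103H1Complex (SiteL2K covLaplaceSiteK covDerivL2K equiv_covDerivL2K)
open B9Eq323KatoDomination (equiv_covLaplaceSiteK_eq_sum)

/-! ## §1 One direction, abstract: the pairing identity and its size -/

section Algebra

variable {𝕜 : Type*} [CommRing 𝕜] {V : Type*} [AddCommGroup V] [Module 𝕜 V]

/-- **THE PAIRING IDENTITY (one direction `μ` at a site `x`).**  Transporters of the first datum `Rp = R(x,μ)`, `Rm = R(x−e_μ,μ)`, `Sm = S(x−e_μ,μ)` and of the second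
`Rp′, Sp′` (on `(x,μ)`), `Rm′, Sm′` (on `(x−e_μ,μ)`) with `Sp′Rp′ = 1`, `SmRm = 1`, `Sm′Rm′ = 1`; values `v₊ = v(x+e_μ)`, `v₀ = v(x)`, `v₋ = v(x−e_μ)`.  With the relative
transporters `Bx = RpSp′ − 1`, `Bm = RmSm′ − 1` (written out):
`(Rp′v₊ − Rp v₊) + (Sm′v₋ − Sm v₋) = −Bx(Rp′v₊ − v₀) + (Sm − Sm′)(Rm′v₀ − v₋) − [(Bx v₀ − Sm Bm Rm v₀) + Sm Bm Bm Rm′ v₀]` — the `U′`-covariant differences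
`Rp′v₊ − v₀`, `Rm′v₀ − v₋` carry the first order; the zeroth order is the `U`-covariant backward DIFFERENCE of `B` plus a SQUARE of `B`.  (t4-ne9-idea-1 g131
`pairing_identity` + `paired_letter_identity`, g123 §8; for linear maps.) [folklore] [cite: Balaban1985BackgroundPropagators, (3.70)–(3.71) p.404, (3.73) p.405] -/
theorem pairing_identity (Rp Rp' Sp' Rm Sm Rm' Sm' : V →ₗ[𝕜] V) (hp' : ∀ w, Sp' (Rp' w) = w) (hm : ∀ w, Sm (Rm w) = w)
    (hm' : ∀ w, Sm' (Rm' w) = w) (vp v0 vm : V) :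
    (Rp' vp - Rp vp) + (Sm' vm - Sm vm) =
      -(Rp (Sp' (Rp' vp - v0)) - (Rp' vp - v0)) + (Sm (Rm' v0 - vm) - Sm' (Rm' v0 - vm))
        - (((Rp (Sp' v0) - v0) - Sm (Rm (Sm' (Rm v0)) - Rm v0))
          + Sm (Rm (Sm' (Rm (Sm' (Rm' v0)) - Rm' v0)) - (Rm (Sm' (Rm' v0)) - Rm' v0))) := by
  simp only [map_sub, hp', hm, hm']
  abel

end Algebra

section Size

variable {𝕜 : Type*} [NormedField 𝕜] {V : Type*} [SeminormedAddCommGroup V] [NormedSpace 𝕜 V]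

/-- **SIZE OF THE PAIRED REMAINDER (one direction).**  If the relative transporters are small — `‖Rp(Sp′u) − u‖ ≤ b‖u‖`, `‖Sm u − Sm′u‖ ≤ b‖u‖`, `‖Rm(Sm′u) − u‖ ≤ b‖u‖`
(`0 ≤ b`) —, the covariant difference of `B` is small — `‖(Rp(Sp′u) − u) − Sm(Rm(Sm′(Rm u)) − Rm u)‖ ≤ b′‖u‖` —, and `Sm`, `Rm′` contract, then
`‖(Rp′v₊ − Rp v₊) + (Sm′v₋ − Sm v₋)‖ ≤ b·‖Rp′v₊ − v₀‖ + b·‖Rm′v₀ − v₋‖ + (b′ + b²)·‖v₀‖`.  (g131 `pairing_norm_le`.) [folklore]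
[cite: Balaban1985BackgroundPropagators, (3.73) p.405] -/
theorem norm_pairing_le (Rp Rp' Sp' Rm Sm Rm' Sm' : V →ₗ[𝕜] V) (hp' : ∀ w, Sp' (Rp' w) = w) (hm : ∀ w, Sm (Rm w) = w)
    (hm' : ∀ w, Sm' (Rm' w) = w) {b b' : ℝ} (hb : 0 ≤ b) (hBx : ∀ u, ‖Rp (Sp' u) - u‖ ≤ b * ‖u‖) (hBt : ∀ u, ‖Sm u - Sm' u‖ ≤ b * ‖u‖)
    (hBm : ∀ u, ‖Rm (Sm' u) - u‖ ≤ b * ‖u‖) (hD : ∀ u, ‖(Rp (Sp' u) - u) - Sm (Rm (Sm' (Rm u)) - Rm u)‖ ≤ b' * ‖u‖)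
    (hSm : ∀ u, ‖Sm u‖ ≤ ‖u‖) (hRm' : ∀ u, ‖Rm' u‖ ≤ ‖u‖) (vp v0 vm : V) :
    ‖(Rp' vp - Rp vp) + (Sm' vm - Sm vm)‖ ≤ b * ‖Rp' vp - v0‖ + b * ‖Rm' v0 - vm‖ + (b' + b * b) * ‖v0‖ := by
  rw [pairing_identity Rp Rp' Sp' Rm Sm Rm' Sm' hp' hm hm' vp v0 vm]
  have t1 : ‖-(Rp (Sp' (Rp' vp - v0)) - (Rp' vp - v0))‖ ≤ b * ‖Rp' vp - v0‖ := by
    rw [norm_neg]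
    exact hBx _
  have t2 : ‖Sm (Rm' v0 - vm) - Sm' (Rm' v0 - vm)‖ ≤ b * ‖Rm' v0 - vm‖ := hBt _
  have t3 : ‖(Rp (Sp' v0) - v0) - Sm (Rm (Sm' (Rm v0)) - Rm v0)‖ ≤ b' * ‖v0‖ := hD _
  have t4 : ‖Sm (Rm (Sm' (Rm (Sm' (Rm' v0)) - Rm' v0)) - (Rm (Sm' (Rm' v0)) - Rm' v0))‖ ≤ b * b * ‖v0‖ :=
    calc ‖Sm (Rm (Sm' (Rm (Sm' (Rm' v0)) - Rm' v0)) - (Rm (Sm' (Rm' v0)) - Rm' v0))‖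
        ≤ ‖Rm (Sm' (Rm (Sm' (Rm' v0)) - Rm' v0)) - (Rm (Sm' (Rm' v0)) - Rm' v0)‖ := hSm _
      _ ≤ b * ‖Rm (Sm' (Rm' v0)) - Rm' v0‖ := hBm _
      _ ≤ b * (b * ‖Rm' v0‖) := mul_le_mul_of_nonneg_left (hBm _) hb
      _ ≤ b * (b * ‖v0‖) := mul_le_mul_of_nonneg_left (mul_le_mul_of_nonneg_left (hRm' _) hb) hb
      _ = b * b * ‖v0‖ := by ring
  refine (norm_sub_le _ _).trans ?_
  refine (add_le_add (norm_add_le _ _) (norm_add_le _ _)).trans ?_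
  linarith [t1, t2, t3, t4]

end Size

/-! ## §2 The chain's covariant Laplace operator (3.23) under a change of transporter data -/

section Lattice

variable {𝕜 : Type*} [RCLike 𝕜] {d : ℕ} {Pd : Fin d → ℕ} {W : Type*} [NormedAddCommGroup W] [InnerProductSpace 𝕜 W]
  {c₀ : ℝ} [Fact (0 < c₀)]

/-- **THE TWO-DATA DIFFERENCE OF (3.23), RAW**: for transporter data `(R, S)`, `(R′, S′)` with `S(b)R(b) = 1 = S′(b)R′(b)` and real `t`, at every site
`(Δ_{R,S}f)(x) − (Δ_{R′,S′}f)(x) = Σ_μ t²•[(S′(x−e_μ,μ) − S(x−e_μ,μ))f(x−e_μ) + (R′(x,μ) − R(x,μ))f(x+e_μ)]` — one transporter difference per slot against the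
undifferentiated `f` (the UNPAIRED form; with `t = η⁻¹` and `‖R − R′‖ = O(ηa)` it costs `η⁻¹a`). [folklore] [cite: Balaban1985BackgroundPropagators, (3.23) p.394] -/
theorem equiv_covLaplaceSiteK_sub_eq_sum (t : ℝ) (R S R' S' : Bond d Pd → W →ₗ[𝕜] W) (hSR : ∀ b w, S b (R b w) = w) (hSR' : ∀ b w, S' b (R' b w) = w)
    (f : SiteL2K 𝕜 d Pd c₀ W) (x : TSite d Pd) :
    WL2.equiv 𝕜 _ W (covLaplaceSiteK (t : 𝕜) R S f) x - WL2.equiv 𝕜 _ W (covLaplaceSiteK (t : 𝕜) R' S' f) x =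
      ∑ μ, ((t ^ 2 : ℝ) : 𝕜) • ((S' (unshift μ x, μ) (WL2.equiv 𝕜 _ W f (unshift μ x)) - S (unshift μ x, μ) (WL2.equiv 𝕜 _ W f (unshift μ x))) +
        (R' (x, μ) (WL2.equiv 𝕜 _ W f (shift μ x)) - R (x, μ) (WL2.equiv 𝕜 _ W f (shift μ x)))) := by
  rw [equiv_covLaplaceSiteK_eq_sum t R S hSR f x, equiv_covLaplaceSiteK_eq_sum t R' S' hSR' f x, ← Finset.sum_sub_distrib]
  refine Finset.sum_congr rfl fun μ _ => ?_
  rw [← smul_sub]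
  congr 1
  abel

/-- **THE TWO-DATA DIFFERENCE OF (3.23), PAIRED AND SIZED.**  Data `(R,S)`, `(R′,S′)` with `S(b)R(b) = 1 = S′(b)R′(b)`, real `t`, a site `x`, and for every direction `μ`
the five letters at the bonds `(x,μ)` and `(x−e_μ,μ)`: relative transporters `‖R(x,μ)S′(x,μ)u − u‖, ‖R(x−e_μ,μ)S′(x−e_μ,μ)u − u‖, ‖(S − S′)(x−e_μ,μ)u‖ ≤ b‖u‖` (`0 ≤ b`),
the `U`-COVARIANT DIFFERENCE of the relative transporter `‖(R S′ − 1)(x,μ)u − S(x−e_μ,μ)(R S′ − 1)(x−e_μ,μ)R(x−e_μ,μ)u‖ ≤ b′‖u‖`, contractions `‖S(x−e_μ,μ)u‖, ‖R′(x−e_μ,μ)u‖ ≤ ‖u‖`.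
Then, with `D′f = covDerivL2K 𝕜 c₀ t R′ f` the covariant derivative of the SECOND datum,
`‖(Δ_{R,S}f)(x) − (Δ_{R′,S′}f)(x)‖ ≤ |t|·b·Σ_μ(‖(D′f)(x,μ)‖ + ‖(D′f)(x−e_μ,μ)‖) + d·(t²(b′ + b²))·‖f(x)‖` — in the units `t = η⁻¹`, `b = ηa`, `b′ = η²a′`:
`≤ a·Σ_μ(‖D′f‖ + ‖D′f‖) + d(a′ + a²)‖f(x)‖`, NO `η⁻¹`.  Proof: `pairing_identity` ∕ `norm_pairing_le` per direction, `covDeriv_apply_dir`, `shift_unshift`. [folklore]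
[cite: Balaban1985BackgroundPropagators, (3.23) p.394, (3.70)–(3.71) p.404, (3.73) p.405] -/
theorem norm_equiv_covLaplaceSiteK_sub_le_paired (t : ℝ) (R S R' S' : Bond d Pd → W →ₗ[𝕜] W) (hSR : ∀ b w, S b (R b w) = w)
    (hSR' : ∀ b w, S' b (R' b w) = w) (f : SiteL2K 𝕜 d Pd c₀ W) (x : TSite d Pd) {b b' : ℝ} (hb : 0 ≤ b)
    (hBp : ∀ μ u, ‖R (x, μ) (S' (x, μ) u) - u‖ ≤ b * ‖u‖) (hBm : ∀ μ u, ‖R (unshift μ x, μ) (S' (unshift μ x, μ) u) - u‖ ≤ b * ‖u‖)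
    (hBt : ∀ μ u, ‖S (unshift μ x, μ) u - S' (unshift μ x, μ) u‖ ≤ b * ‖u‖)
    (hD : ∀ μ u, ‖(R (x, μ) (S' (x, μ) u) - u) -
      S (unshift μ x, μ) (R (unshift μ x, μ) (S' (unshift μ x, μ) (R (unshift μ x, μ) u)) - R (unshift μ x, μ) u)‖ ≤ b' * ‖u‖)
    (hS : ∀ μ u, ‖S (unshift μ x, μ) u‖ ≤ ‖u‖) (hR' : ∀ μ u, ‖R' (unshift μ x, μ) u‖ ≤ ‖u‖) :
    ‖WL2.equiv 𝕜 _ W (covLaplaceSiteK (t : 𝕜) R S f) x - WL2.equiv 𝕜 _ W (covLaplaceSiteK (t : 𝕜) R' S' f) x‖ ≤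
      |t| * b * ∑ μ, (‖WL2.equiv 𝕜 _ W (covDerivL2K 𝕜 c₀ (t : 𝕜) R' f) (x, μ)‖ + ‖WL2.equiv 𝕜 _ W (covDerivL2K 𝕜 c₀ (t : 𝕜) R' f) (unshift μ x, μ)‖) +
        d * (t ^ 2 * (b' + b * b)) * ‖WL2.equiv 𝕜 _ W f x‖ := by
  set F := WL2.equiv 𝕜 _ W f with hF
  have hDp : ∀ μ, WL2.equiv 𝕜 _ W (covDerivL2K 𝕜 c₀ (t : 𝕜) R' f) (x, μ) = (t : 𝕜) • (R' (x, μ) (F (shift μ x)) - F x) := fun μ => by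
    rw [equiv_covDerivL2K, covDeriv_apply_dir]
  have hDm : ∀ μ, WL2.equiv 𝕜 _ W (covDerivL2K 𝕜 c₀ (t : 𝕜) R' f) (unshift μ x, μ) = (t : 𝕜) • (R' (unshift μ x, μ) (F x) - F (unshift μ x)) :=
    fun μ => by rw [equiv_covDerivL2K, covDeriv_apply_dir, shift_unshift]
  have ht : ‖((t : ℝ) : 𝕜)‖ = |t| := RCLike.norm_ofReal t
  have ht2 : ‖((t ^ 2 : ℝ) : 𝕜)‖ = t ^ 2 := by rw [RCLike.norm_ofReal, abs_of_nonneg (sq_nonneg t)]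
  -- per direction
  have hμ : ∀ μ, ‖((t ^ 2 : ℝ) : 𝕜) • ((S' (unshift μ x, μ) (F (unshift μ x)) - S (unshift μ x, μ) (F (unshift μ x))) +
      (R' (x, μ) (F (shift μ x)) - R (x, μ) (F (shift μ x))))‖ ≤
      |t| * b * (‖WL2.equiv 𝕜 _ W (covDerivL2K 𝕜 c₀ (t : 𝕜) R' f) (x, μ)‖ + ‖WL2.equiv 𝕜 _ W (covDerivL2K 𝕜 c₀ (t : 𝕜) R' f) (unshift μ x, μ)‖) +
        t ^ 2 * (b' + b * b) * ‖F x‖ := fun μ => by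
    rw [hDp, hDm, norm_smul, norm_smul, norm_smul, ht, ht2, add_comm (S' (unshift μ x, μ) (F (unshift μ x)) - _ ) _]
    have hpair := norm_pairing_le (R (x, μ)) (R' (x, μ)) (S' (x, μ)) (R (unshift μ x, μ)) (S (unshift μ x, μ)) (R' (unshift μ x, μ))
      (S' (unshift μ x, μ)) (hSR' _) (hSR _) (hSR' _) hb (hBp μ) (hBt μ) (hBm μ) (hD μ) (hS μ) (hR' μ) (F (shift μ x)) (F x) (F (unshift μ x))
    have e : |t| * b * (|t| * ‖R' (x, μ) (F (shift μ x)) - F x‖ + |t| * ‖R' (unshift μ x, μ) (F x) - F (unshift μ x)‖) =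
        t ^ 2 * (b * ‖R' (x, μ) (F (shift μ x)) - F x‖ + b * ‖R' (unshift μ x, μ) (F x) - F (unshift μ x)‖) := by
      rw [← sq_abs t]
      ring
    rw [e, mul_assoc (t ^ 2) (b' + b * b), ← mul_add (t ^ 2)]
    exact mul_le_mul_of_nonneg_left hpair (sq_nonneg t)
  rw [equiv_covLaplaceSiteK_sub_eq_sum t R S R' S' hSR hSR' f x]
  calc ‖∑ μ, ((t ^ 2 : ℝ) : 𝕜) • ((S' (unshift μ x, μ) (F (unshift μ x)) - S (unshift μ x, μ) (F (unshift μ x))) +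
          (R' (x, μ) (F (shift μ x)) - R (x, μ) (F (shift μ x))))‖
      ≤ ∑ μ, ‖((t ^ 2 : ℝ) : 𝕜) • ((S' (unshift μ x, μ) (F (unshift μ x)) - S (unshift μ x, μ) (F (unshift μ x))) +
          (R' (x, μ) (F (shift μ x)) - R (x, μ) (F (shift μ x))))‖ := norm_sum_le _ _
    _ ≤ ∑ μ, (|t| * b * (‖WL2.equiv 𝕜 _ W (covDerivL2K 𝕜 c₀ (t : 𝕜) R' f) (x, μ)‖ +
          ‖WL2.equiv 𝕜 _ W (covDerivL2K 𝕜 c₀ (t : 𝕜) R' f) (unshift μ x, μ)‖) + t ^ 2 * (b' + b * b) * ‖F x‖) := Finset.sum_le_sum fun μ _ => hμ μ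
    _ = |t| * b * ∑ μ, (‖WL2.equiv 𝕜 _ W (covDerivL2K 𝕜 c₀ (t : 𝕜) R' f) (x, μ)‖ + ‖WL2.equiv 𝕜 _ W (covDerivL2K 𝕜 c₀ (t : 𝕜) R' f) (unshift μ x, μ)‖) +
        d * (t ^ 2 * (b' + b * b)) * ‖F x‖ := by
      rw [Finset.sum_add_distrib, ← Finset.mul_sum, Finset.sum_const, Finset.card_univ, Fintype.card_fin, nsmul_eq_mul]
      ring

end Lattice

end Literature.MathematicalPhysics.QuantumFieldTheory.Balaban1983to89.B9Eq373KatoPairedRemainder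

end
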